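import Mathlib
import Summits.Ventures.PercRepro2.KPrimeSure
import Summits.Ventures.PercRepro2.CycleConn

/-!
# `(K′)` on the 5-cycle: the configurations, decidability, and the sum over the `32` configurations
(blind cell PercRepro2, mine-c g41; `conjectures/MINE-C.md` §50)

The lemma of record `(K′)` of the `(C-MONO)` chain (`KPrime.kprimeForm`, `KPrimeReduction.lean`;
`KPrime.KPrimeHolds`, `KPrimeSure.lean`) on the `5`-cycle `cycN 5` (`V = E = Fin 5`, edge `i` joins
`i` and `i + 1`).  Every event of the form is a Boolean combination of mark connectivities, and on
the cycle `u ↔ v` iff one of the two arcs between them is fully open (`conn_cycle_iff`), so every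
event is DECIDABLE (`connB`, `instDecidableConn`) and every probability is the explicit sum over the
`32` configurations `cfg 0, …, cfg 31` (`prob_eq_sum_cfg`).  The companion files
`KPrimeCycle5Cert*.lean` evaluate the ten masses of the form at every placement of the five marks
with `a₁ = 0` and exhibit the cleared form as a sum of Bernstein monomials
`∏ᵢ wᵢ^{sᵢ} (1 − wᵢ)^{3 − sᵢ}` with NONNEGATIVE integer coefficients (the tensor-Bernstein
certificate of `MINE-C.md` §50.2: `0` negative coefficients on all `24` placements) — hence
`(K′)` on `C₅` for EVERY weight vector, which transports to every cycle (`KPrimeCycle.lean`).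
-/

namespace Summit.Ventures.PercRepro2

namespace KPrimeCycle5

open Cycle

/-- Connectivity on the `5`-cycle, decided through the two arcs. -/
def connB (ω : Config (Fin 5)) (u v : Fin 5) : Bool :=
  decide ((∀ i ∈ upInterval u v, ω i = true) ∨ (∀ i ∈ upInterval v u, ω i = true))

/-- `connB` is connectivity on the `5`-cycle. -/
lemma conn_iff_connB (ω : Config (Fin 5)) (u v : Fin 5) :
    Conn (cycN 5) ω u v ↔ connB ω u v = true := by
  rw [connB, decide_eq_true_iff, conn_cycle_iff]

/-- Connectivity on the `5`-cycle is decidable. -/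
instance instDecidableConn (ω : Config (Fin 5)) (u v : Fin 5) :
    Decidable (Conn (cycN 5) ω u v) :=
  decidable_of_iff _ (conn_iff_connB ω u v).symm

/-- Membership in a connection event of the `5`-cycle is decidable. -/
instance instDecidableMemConnEvent (u v : Fin 5) :
    DecidablePred (· ∈ connEvent (cycN 5) u v) :=
  fun ω => (instDecidableConn ω u v : Decidable (Conn (cycN 5) ω u v))

/-- Membership in an avoidance event of the `5`-cycle is decidable. -/
instance instDecidableMemAvoidAll (s : Fin 5) (X : Finset (Fin 5)) :
    DecidablePred (· ∈ avoidAll (cycN 5) s X) :=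
  fun ω => (inferInstance : Decidable (∀ x ∈ X, ¬ Conn (cycN 5) ω s x))

/-- Membership in `Ω` is decidable. -/
instance instDecidableMemΩ (a₁ a₂ : Fin 5) : DecidablePred (· ∈ KPrime.Ω (cycN 5) a₁ a₂) :=
  fun ω => (inferInstance : Decidable (ω ∈ avoidAll (cycN 5) a₁ {a₂}))

/-- Membership in `S` is decidable. -/
instance instDecidableMemS (a₁ a₂ v : Fin 5) : DecidablePred (· ∈ KPrime.S (cycN 5) a₁ a₂ v) :=
  fun ω => (inferInstance : Decidable (ω ∈ avoidAll (cycN 5) a₂ {a₁, v}))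

/-- Membership in `N` is decidable. -/
instance instDecidableMemN (a₁ a₂ v : Fin 5) : DecidablePred (· ∈ KPrime.N (cycN 5) a₁ a₂ v) :=
  fun ω => (inferInstance : Decidable (ω ∈ avoidAll (cycN 5) a₁ {a₂, v}))

/-- Membership in the class `(0,1)` is decidable. -/
instance instDecidableMemCls01 (a₁ a₂ v y : Fin 5) :
    DecidablePred (· ∈ KPrime.cls01 (cycN 5) a₁ a₂ v y) :=
  fun ω => (inferInstance : Decidable (ω ∈ (connEvent (cycN 5) a₁ v)ᶜ ∩ connEvent (cycN 5) a₁ y ∩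
    KPrime.S (cycN 5) a₁ a₂ v))

/-- Membership in the glued class `(0,1)ᵉ` is decidable. -/
instance instDecidableMemCls01e (a₁ a₂ b v y : Fin 5) :
    DecidablePred (· ∈ KPrime.cls01e (cycN 5) a₁ a₂ b v y) :=
  fun ω => (inferInstance : Decidable (ω ∈ (connEvent (cycN 5) a₁ v)ᶜ ∩ connEvent (cycN 5) a₁ y ∩
    KPrime.S (cycN 5) a₁ a₂ v ∩ (connEvent (cycN 5) a₁ b ∪ connEvent (cycN 5) v b)))

/-- The `i`-th binary digit of `k`, as a Boolean. -/
def bit (k i : ℕ) : Bool := decide (k / 2 ^ i % 2 = 1)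

/-- The configuration of the `5`-cycle with the binary digits of `k`. -/
def cfg (k : ℕ) : Config (Fin 5) := ![bit k 0, bit k 1, bit k 2, bit k 3, bit k 4]

/-- The index of a configuration: its binary value. -/
def idx (ω : Config (Fin 5)) : ℕ :=
  (if ω 0 then 1 else 0) + (if ω 1 then 2 else 0) + (if ω 2 then 4 else 0) +
    (if ω 3 then 8 else 0) + (if ω 4 then 16 else 0)

/-- The index is below `32`. -/
lemma idx_lt (ω : Config (Fin 5)) : idx ω < 32 := by
  unfold idx; split_ifs <;> omega

/-- `cfg ∘ idx = id`. -/
lemma cfg_idx (ω : Config (Fin 5)) : cfg (idx ω) = ω := by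
  revert ω; decide

/-- `idx ∘ cfg = id` below `32`. -/
lemma idx_cfg (k : Fin 32) : idx (cfg k.val) = k.val := by
  revert k; decide

/-- The configurations of the `5`-cycle, indexed by `Fin 32`. -/
def cfgEquiv : Fin 32 ≃ Config (Fin 5) where
  toFun k := cfg k.val
  invFun ω := ⟨idx ω, idx_lt ω⟩
  left_inv k := Fin.ext (idx_cfg k)
  right_inv ω := cfg_idx ω

section Sum

variable {R : Type*} [CommRing R]

/-- A probability on the `5`-cycle as the sum over the `32` configurations. -/
lemma prob_eq_sum_cfg (p : Fin 5 → R) (A : Set (Config (Fin 5))) [DecidablePred (· ∈ A)] :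
    prob p A = ∑ k ∈ Finset.range 32, if cfg k ∈ A then weight p (cfg k) else 0 := by
  have h1 := cfgEquiv.sum_comp (fun ω => A.indicator (weight p) ω)
  unfold prob
  rw [← h1, ← Fin.sum_univ_eq_sum_range (fun k => if cfg k ∈ A then weight p (cfg k) else 0) 32]
  refine Finset.sum_congr rfl fun k _ => ?_
  simp only [Set.indicator_apply, cfgEquiv, Equiv.coe_fn_mk]

end Sum

end KPrimeCycle5

end Summit.Ventures.PercRepro2
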